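import Summits.ABC.IUTFork.LDHGenuinePrintIsmPacket
import Summits.ABC.IUTFork.LDHGenuinePerImageZeroGain
import HarnessLib

/-!
# The fork at [IUTchIII] Corollary 3.12, L-DH level, READING (P) with the Θ-side computed over PRINT's (Ind2): ZERO gain —
# `Σ_p ln ν̄_{𝕃_p}(hull of the print-(Ind2)-orbit of O_𝕃(−P_Θ)) = −deĝ̲_lgp(P_Θ)` at every genuine input, so the per-image
# inequality over print's `Ism` FAILS at every genuine datum with `l ≥ 5`, `log q^{∤2l}(λ) ≥ 24`
# (abc-iut cell, crux ThetaPartII = stmt-ABC-19678; row «C:PERIMAGE-PRINT-ISM», sequel of `LDHGenuinePrintIsmPacket`)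

Record-only PROOF file (D-0012; no definition, no `Prop` fact) of the abc-iut cell (WAVE-3 discharge seat abc-iut-c312-d1, gen 11). TAKES NO
SIDE on [IUTchIII] Cor. 3.12.

CONTEXT. The cell's typed per-image reading (P) of [IUTchIII] Cor. 3.12 at a genuine input `I` (`ThetaVolumeInput.Cor312PerImageOf`) takes the
Θ-side over the Dupuy–Hilado CONTAINER `Aut_{ℚ_p}(V : log_p(R_I^×))` (`TensorPacketShell.indTwo`) and HOLDS at every tabulated Szpiro-bad datum
(different + shell gain; this lineage's «C:PERIMAGE-*» rows). Gen 10 (p500042 / p500550 / p503117 / p503854 / p504965) put the (Ind2)-dependence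
in kernel: the Θ-side is MONOTONE in the sub-indeterminacy `H ≤ container` and sits at the BARE value `−deĝ̲_lgp(P_Θ)` whenever `H` stabilises the
Θ-regions (unit homotheties `ℤ_p^× = Im(Ẑ^×)` in particular), where the (P)-inequality fails as soon as `log q^{∤2l}(λ) ≥ 24`. `LDHGenuinePrintIsmPacket`
(this row, part 1) proved that PRINT's (Ind2) as typed by abc-iut-c312-1 — factorwise `Real.ismIsm (analyticLogv K) v̲_b`, computed by abc-iut-w5-d216
to be exactly `ℤ_p^×·id` on `K_{v̲}` (p452975) — acts on every genuine tensor packet as the unit homotheties. THIS FILE draws the input- and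
datum-level consequence, the Θ-side over print's (Ind2) being written INLINE (no definition):

* `DHData.ofIdelesM_lnνLp_regionΘ`, `DHData.lnνLp_regionΘ_ofInput`, **`DHData.sum_lnνLp_pilotRegion_eq_neg_ndegLgp`** — Dupuy–Hilado Thm. 3.10.1
  at `P_Θ` in the input currency: `Σ_{p ∈ T(I)} ln ν̄_{𝕃_p}(O_𝕃(−P_Θ)_p) = −deĝ̲_lgp(P_Θ)` for the bare regions of the input's real packets
  (abc-iut-c312-3's `lnνL_regionΘ` for `DHData.ofInput I`, evaluated primewise as in this lineage's `ofIdelesM_lnνLp_hullUThetaSlot`);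
* **`ThetaVolumeInput.sum_lnνLp_hull_printInd2_eq_neg_ndegLgp`** — for ANY family `H = (H_{p,v⃗})` of subgroups of the packet automorphisms of
  the input's genuine packets DOMINATED BY PRINT's (Ind2) (each `g ∈ H_{p,v⃗}` acts on pure tensors factorwise through elements of
  `Real.ismIsm (analyticLogv K) v̲_b`, [IUTchIII] Thm. 3.11 (i) (Ind2) p. 154 l. 55–64 «independent copies of Ism … on each of the direct
  summands of the j+1 factors»): `Σ_{p ∈ T(I)} ln ν̄_{𝕃_p}(v⃗ ↦ hull(⋃_{g ∈ H_{p,v⃗}} g(O_𝕃(−P_Θ)_{v⃗}))) = −deĝ̲_lgp(P_Θ)` — ZERO (Ind2)-gain;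
* `ThetaVolumeInput.gap_le_arch_of_perImage_printInd2` — hence the (P)-inequality with that Θ-side, `−|log(q)| ≤ [Θ-side over print's (Ind2)] +
  ((l+5)/4)·log π` (HYPOTHESIS, inline), squeezes to `deĝ̲_lgp(P_Θ) − deĝ̲(P_q) ≤ ((l+5)/4)·log π`;
* `Cor22.ThetaVolumeDatumAt.arch_lt_gap_of_le` (arithmetic: `l ≥ 5`, `Q ≥ 24` ⟹ `((l+5)/4)·log π < κ_l·Q`, `κ_l = (l+1)/24 − 1/(2l)`);
  **`Cor22.ThetaVolumeDatumAt.not_perImage_printInd2_of_le`** — at the Θ-data of a `λ`-line point `P ∈ U` and a prime `l ≥ 5` with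
  `log q^{∤{2,l}}(λ) ≥ 24` (every tabulated Szpiro-bad datum of the cell has `log q^{∤2l} > 40`): for EVERY genuine datum `T` and EVERY
  print-dominated `H`, `¬ (−|log(q)| ≤ [Θ-side over H] + ((l+5)/4)·log π)`.

READING (numbers about OUR typed objects; the C LEAD's words of record decide the booking): in the cell's kernel (Ind2)-dichotomy the TYPED
per-image Corollary holds at the tabulated data only through container elements OUTSIDE print's `Ism` as typed by c312-1 (`GL_{ℤ_p}(I_v) ∖ ℤ_p^×`:
lattice shears, non-isometries); with the Θ-side computed over print's factorwise `Ism` the (P)-inequality is false at every genuine datum with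
`l ≥ 5`, `log q^{∤2l}(λ) ≥ 24`, and by `localFields_lnνLp_hull_printInd2_slotUnion_eq` the (U)-reading then carries only the (Ind1)-slot residue
(abc-iut-s2-p2; `0` at slot-constant data, e.g. `F_mod = ℚ`). Whether print's EFFECTIVE (Ind2) at `v ∈ 𝕍^bad` is this factorwise `Ism` or
acts before the log / tensor passage (ref-b F-B28-1: «typed-(P) does not decide print-(P)»), and (Ind1), (Ind3), the log-link, Cor. 3.12 itself,
are untouched; nothing here asserts the existence of data, that abc is proved or refuted, or takes a side.
[cite: Mochizuki2012, IUTchIII Cor. 3.12 p. 173–174; proof Step (x) p. 181; Thm. 3.11 (i) p. 154] [cite: Mochizuki2012, IUTchIV Thm. 1.10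
Steps (v)–(viii) p. 27–31] [cite: Mochizuki2012, IUTchII Ex. 1.8 (iv) p. 39] [cite: DupuyHilado2025, §3.9, §4.9, §4.12, Thm. 3.10.1]
[claim: Mochizuki2012, status: disputed] for every IUT quotation. Axioms: standard three.
-/

noncomputable section

open Set Module NumberField IsDedekindDomain
open scoped Pointwise TensorProduct

namespace Summit.ABC.IUTFork

open Literature.IUT.LogVolume Literature.NumberTheory.NumberFields Thm311.Real

/-! ## 1. Input level: `ln ν̄_{𝕃_p}` of the BARE Θ-region at a prime, and the sum over the support primes -/

namespace DHData

section IdelesM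

variable {F₀ : Type} [Field F₀] [NumberField F₀]
variable (X : PilotData F₀) (𝔽 : LocalFieldFamily F₀)
  (tΘ : ∀ (p : ℕ) (hp : p.Prime), Fin X.lstar → (v : placesOver F₀ p) → (@LocalFields.k F₀ _ _ p ⟨hp⟩ (𝔽 p hp) v)ˣ)
  (tΘ_ord : ∀ (p : ℕ) (hp : p.Prime) (i : Fin X.lstar) (v : placesOver F₀ p),
    @LocalFields.ordv F₀ _ _ p ⟨hp⟩ (𝔽 p hp) v (tΘ p hp i v) = X.thetaPilot i v.1)
  (tq : ∀ (p : ℕ) (hp : p.Prime), Fin X.lstar → (v : placesOver F₀ p) → (@LocalFields.k F₀ _ _ p ⟨hp⟩ (𝔽 p hp) v)ˣ)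
  (tq_ord : ∀ (p : ℕ) (hp : p.Prime) (i : Fin X.lstar) (v : placesOver F₀ p),
    @LocalFields.ordv F₀ _ _ p ⟨hp⟩ (𝔽 p hp) v (tq p hp i v) = X.qPilot v.1)
  (T : Finset ℕ) (T_prime : ∀ p ∈ T, p.Prime) (S_sub : ∀ v ∈ X.S, residueChar F₀ v ∈ T)

/-- **`ln ν̄_{𝕃_p}(O_𝕃(−P_Θ)_p)` of the idele-built datum, at a prime `p`, is the BARE-region volume of the REAL packet at `p`**
(the Θ-twin of abc-iut-S2's `ofIdelesM_lnνLp_region_tq` and of this lineage's `ofIdelesM_lnνLp_hullUThetaSlot`: the `p`-part of the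
assembled model evaluated through the `dite`/transport of `ofPrimesLine`). [cite: DupuyHilado2025, Def. 3.6.3, §3.9] -/
theorem ofIdelesM_lnνLp_regionΘ {p : ℕ} (hp : p.Prime) :
    (ofIdelesM X 𝔽 tΘ tΘ_ord tq tq_ord T T_prime S_sub).M.lnνLp X.lstar p
        ((ofIdelesM X 𝔽 tΘ tΘ_ord tq tq_ord T T_prime S_sub).M.region
          (ofIdelesM X 𝔽 tΘ tΘ_ord tq tq_ord T T_prime S_sub).tΘ) =
      (@realPrimePacketM F₀ _ _ p ⟨hp⟩ (𝔽 p hp)).lnνLp X.lstar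
        ((@realPrimePacketM F₀ _ _ p ⟨hp⟩ (𝔽 p hp)).pilotRegion (tΘ p hp)) := by
  rw [IndPacketModel.lnνLp_eq_primePart, IndPacketModel.region_eq_regionOf, ← PrimePacket.regionOf_eq_pilotRegion]
  -- evaluate the `dite` of `ofPrimesLine` at the prime `p` (abc-iut-S2's `DHDatum.dite_eval`)
  show (if hp : p.Prime then @realPrimePacketM F₀ _ _ p ⟨hp⟩ (𝔽 p hp) else PrimePacket.line F₀ p).lnνLp X.lstar
      ((if hp : p.Prime then @realPrimePacketM F₀ _ _ p ⟨hp⟩ (𝔽 p hp) else PrimePacket.line F₀ p).regionOf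
        (if hp : p.Prime then
            PrimePacket.DHDatum.transport (dif_pos hp)
              (@PrimePacket.minimalDHDatumM F₀ _ _ p ⟨hp⟩ (𝔽 p hp) X (tΘ p hp) (tΘ_ord p hp) (tq p hp) (tq_ord p hp))
          else PrimePacket.DHDatum.transport (dif_neg hp) (PrimePacket.lineDatum p X) :
          ((if hp : p.Prime then @realPrimePacketM F₀ _ _ p ⟨hp⟩ (𝔽 p hp) else PrimePacket.line F₀ p)).DHDatum X).tΘ) = _
  exact PrimePacket.DHDatum.dite_eval (X := X) (p.Prime) hp _ _ _ _
    (fun Q d => Q.lnνLp X.lstar (Q.regionOf d.tΘ))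

end IdelesM

variable {F₀ : Type} [Field F₀] [NumberField F₀] {K : Type} [Field K] [NumberField K] [Algebra F₀ K]
variable (I : ThetaVolumeInput F₀ K)

/-- At a prime `p`, `ln ν̄_{𝕃_p}(O_𝕃(−P_Θ)_p)` of the datum OF a genuine input is the bare-region volume of the input's real packet
`I.packetAt p` at its Θ-idele. [cite: DupuyHilado2025, Def. 3.6.3, §3.9] -/
theorem lnνLp_regionΘ_ofInput {p : ℕ} (hp : p.Prime) :
    (ofInput I).M.lnνLp I.lstar p ((ofInput I).M.region (ofInput I).tΘ) =
      (I.packetAt p hp).lnνLp I.lstar ((I.packetAt p hp).pilotRegion (I.tΘ p hp)) :=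
  ofIdelesM_lnνLp_regionΘ I.X I.σ.localFieldFamily I.tΘ I.tΘ_ord I.tq I.tq_ord I.supportPrimes
    (fun _ hp => I.prime_of_mem_supportPrimes hp) (fun _ hv => I.residueChar_mem_supportPrimes hv) hp

/-- **Dupuy–Hilado Thm. 3.10.1 at `P_Θ`, input currency**: the sum over the support primes of the BARE-region volumes of the input's
real packets is `−deĝ̲_lgp(P_Θ)` (abc-iut-c312-3's `lnνL_regionΘ` for the datum of the input).
[cite: DupuyHilado2025, Thm. 3.10.1] -/
theorem sum_lnνLp_pilotRegion_eq_neg_ndegLgp :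
    (∑ p ∈ I.supportPrimes,
        if hp : p.Prime then (I.packetAt p hp).lnνLp I.lstar ((I.packetAt p hp).pilotRegion (I.tΘ p hp)) else 0) =
      -LgpDivisor.ndegLgp I.X.thetaPilot := by
  refine Eq.trans ?_ (ofInput I).lnνL_regionΘ
  show _ = ∑ p ∈ I.supportPrimes, (ofInput I).M.lnνLp I.lstar p ((ofInput I).M.region (ofInput I).tΘ)
  refine Finset.sum_congr rfl fun p hp => ?_
  rw [dif_pos (I.prime_of_mem_supportPrimes hp), lnνLp_regionΘ_ofInput I (I.prime_of_mem_supportPrimes hp)]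

end DHData

end Summit.ABC.IUTFork

/-! ## 2. The per-image inequality with Θ-side computed over PRINT's (Ind2): at zero gain, hence FALSE at every genuine datum
with `l ≥ 5`, `log q^{∤2l}(λ) ≥ 24` -/

namespace Literature.IUT.LogVolume

open Summit.ABC.IUTFork Summit.ABC.IUTFork.Thm311.Real Literature.NumberTheory.NumberFields

namespace ThetaVolumeInput

variable {F₀ : Type} [Field F₀] [NumberField F₀] {K : Type} [Field K] [NumberField K] [Algebra F₀ K]
variable (I : ThetaVolumeInput F₀ K)

/-- **`−|log(Θ)|^{nonarch}` COMPUTED OVER PRINT's (Ind2) IS `−deĝ̲_lgp(P_Θ)`** (ZERO GAIN). For a genuine Θ-volume input `I` and ANY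
family `H = (H_{p,v⃗})` of subgroups of the packet automorphisms of the input's genuine packets that is DOMINATED BY PRINT's (Ind2) —
every `g ∈ H_{p,v⃗}` acts on pure tensors factorwise through c312-1's `Real.ismIsm (analyticLogv K) v̲_b` ([IUTchIII] Thm. 3.11 (i)
(Ind2) p. 154 «independent copies of Ism … on each of the direct summands of the j+1 factors»; [IUTchII] Ex. 1.8 (iv)) — the
per-image Θ-side `Σ_{p ∈ T(I)} ln ν̄_{𝕃_p}(v⃗ ↦ hull(⋃_{g ∈ H_{p,v⃗}} g(O_𝕃(−P_Θ)_{v⃗})))`, written INLINE, EQUALS `−deĝ̲_lgp(P_Θ)`.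
[cite: Mochizuki2012, IUTchIII Thm. 3.11 (i) p. 154; Cor. 3.12 proof Step (x) p. 181] [cite: DupuyHilado2025, §4.9, §4.12, Thm. 3.10.1]
[claim: Mochizuki2012, status: disputed] -/
theorem sum_lnνLp_hull_printInd2_eq_neg_ndegLgp
    (H : (p : ℕ) → (hp : p.Prime) → (j : ℕ) → (e : Fin (j + 1) → placesOver F₀ p) →
      haveI : Fact p.Prime := ⟨hp⟩
      Subgroup (PacketAlgebra p (fun b => (I.σ.localFields p).k (e b)) ≃ₗ[ℚ_[p]]
        PacketAlgebra p (fun b => (I.σ.localFields p).k (e b))))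
    (hH : ∀ (p : ℕ) (hp : p.Prime), haveI : Fact p.Prime := ⟨hp⟩
      ∀ j e, ∀ g ∈ H p hp j e,
        ∃ ψ : ∀ b : Fin (j + 1), Carrier (.inr (I.σ.lift (e b).1) : Thm311.Real.Place K) ≃ₗ[ℚ]
            Carrier (.inr (I.σ.lift (e b).1) : Thm311.Real.Place K),
          (∀ b, ψ b ∈ ismIsm (analyticLogv K) (I.σ.lift (e b).1)) ∧
          ∀ x : ∀ b, (I.σ.localFields p).k (e b),
            (g : PacketAlgebra p (fun b => (I.σ.localFields p).k (e b)) ≃ₗ[ℚ_[p]]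
                PacketAlgebra p (fun b => (I.σ.localFields p).k (e b))) (PiTensorProduct.tprod ℚ_[p] x) =
              PiTensorProduct.tprod ℚ_[p] (fun b =>
                RescaledCompletion.of K p (I.σ.lift (e b).1) (I.σ.natCast_mem_lift (e b))
                  (ψ b ((RescaledCompletion.of K p (I.σ.lift (e b).1) (I.σ.natCast_mem_lift (e b))).symm (x b))))) :
    (∑ p ∈ I.supportPrimes,
        if hp : p.Prime then
          (haveI : Fact p.Prime := ⟨hp⟩
           (I.packetAt p hp).lnνLp I.lstar (fun j e =>
             packetHull p (fun b => (I.σ.localFields p).k (e b))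
               (⋃ g : H p hp j e, (g : PacketAlgebra p (fun b => (I.σ.localFields p).k (e b)) ≃ₗ[ℚ_[p]]
                   PacketAlgebra p (fun b => (I.σ.localFields p).k (e b))) ''
                 (I.packetAt p hp).pilotRegion (I.tΘ p hp) j e)))
        else 0) =
      -LgpDivisor.ndegLgp I.X.thetaPilot := by
  rw [← DHData.sum_lnνLp_pilotRegion_eq_neg_ndegLgp I]
  refine Finset.sum_congr rfl fun p hpT => ?_
  have hp : p.Prime := I.prime_of_mem_supportPrimes hpT
  rw [dif_pos hp, dif_pos hp]
  haveI : Fact p.Prime := ⟨hp⟩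
  exact localFields_lnνLp_hull_printInd2_eq_pilotRegion I.σ p (mScale p (I.σ.localFields p))
    (mScale_ne_zero p (I.σ.localFields p)) (mScale_perm p (I.σ.localFields p)) (I.tΘ p hp) (H p hp) (hH p hp)

/-- **Hence the per-image inequality over PRINT's (Ind2) squeezes to `deĝ̲_lgp(P_Θ) − deĝ̲(P_q) ≤ ((l+5)/4)·log π`**: IF
`−|log(q)| ≤ [−|log(Θ)|^{nonarch} over print's (Ind2)] + ((l+5)/4)·log π` (the (P)-form of [IUTchIII] Cor. 3.12 with the Θ-side
computed over print's factorwise `Ism` instead of the Dupuy–Hilado container — HYPOTHESIS, inline), THEN the gap of the pilot divisors is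
at most the archimedean summand. Pure bookkeeping; no side taken. [cite: Mochizuki2012, IUTchIV Thm. 1.10 Steps (v)–(viii) p. 27–31]
[claim: Mochizuki2012, status: disputed] -/
theorem gap_le_arch_of_perImage_printInd2
    (H : (p : ℕ) → (hp : p.Prime) → (j : ℕ) → (e : Fin (j + 1) → placesOver F₀ p) →
      haveI : Fact p.Prime := ⟨hp⟩
      Subgroup (PacketAlgebra p (fun b => (I.σ.localFields p).k (e b)) ≃ₗ[ℚ_[p]]
        PacketAlgebra p (fun b => (I.σ.localFields p).k (e b))))
    (hH : ∀ (p : ℕ) (hp : p.Prime), haveI : Fact p.Prime := ⟨hp⟩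
      ∀ j e, ∀ g ∈ H p hp j e,
        ∃ ψ : ∀ b : Fin (j + 1), Carrier (.inr (I.σ.lift (e b).1) : Thm311.Real.Place K) ≃ₗ[ℚ]
            Carrier (.inr (I.σ.lift (e b).1) : Thm311.Real.Place K),
          (∀ b, ψ b ∈ ismIsm (analyticLogv K) (I.σ.lift (e b).1)) ∧
          ∀ x : ∀ b, (I.σ.localFields p).k (e b),
            (g : PacketAlgebra p (fun b => (I.σ.localFields p).k (e b)) ≃ₗ[ℚ_[p]]
                PacketAlgebra p (fun b => (I.σ.localFields p).k (e b))) (PiTensorProduct.tprod ℚ_[p] x) =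
              PiTensorProduct.tprod ℚ_[p] (fun b =>
                RescaledCompletion.of K p (I.σ.lift (e b).1) (I.σ.natCast_mem_lift (e b))
                  (ψ b ((RescaledCompletion.of K p (I.σ.lift (e b).1) (I.σ.natCast_mem_lift (e b))).symm (x b)))))
    (h : I.negAbsLogQ ≤
      (∑ p ∈ I.supportPrimes,
        if hp : p.Prime then
          (haveI : Fact p.Prime := ⟨hp⟩
           (I.packetAt p hp).lnνLp I.lstar (fun j e =>
             packetHull p (fun b => (I.σ.localFields p).k (e b))
               (⋃ g : H p hp j e, (g : PacketAlgebra p (fun b => (I.σ.localFields p).k (e b)) ≃ₗ[ℚ_[p]]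
                   PacketAlgebra p (fun b => (I.σ.localFields p).k (e b))) ''
                 (I.packetAt p hp).pilotRegion (I.tΘ p hp) j e)))
        else 0) + archLogTheta I.l) :
    LgpDivisor.ndegLgp I.X.thetaPilot - FinDivisor.ndeg F₀ I.X.qPilot ≤ archLogTheta I.l := by
  rw [I.sum_lnνLp_hull_printInd2_eq_neg_ndegLgp H hH] at h
  unfold negAbsLogQ at h
  linarith

end ThetaVolumeInput

/-! ### At the Θ-data of a point `(P, l)` -/

namespace Cor22

namespace ThetaVolumeDatumAt

open Literature.NumberTheory.DiophantineGeometry.GenEll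

variable {P : NFPoint} {l : ℕ} (T : ThetaVolumeDatumAt P l)

/-- Arithmetic of the refutation window (the `δ = 0` case of this lineage's p500550): for `l ≥ 5` and `log q^{∤2l}(λ) ≥ 24`,
`((l+5)/4)·log π < ((l+1)/24 − 1/(2l))·log q^{∤2l}(λ)` (`log π ≤ 2·log 2 < 1.3863`). [folklore] -/
theorem arch_lt_gap_of_le (h5 : 5 ≤ l) {Q : ℝ} (hQ : 24 ≤ Q) :
    ((l : ℝ) + 5) / 4 * Real.log Real.pi < (((l : ℝ) + 1) / 24 - 1 / (2 * l)) * Q := by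
  have hl5 : (5 : ℝ) ≤ l := by exact_mod_cast h5
  have hl0 : (0 : ℝ) < l := by linarith
  have hκ : 0 < ((l : ℝ) + 1) / 24 - 1 / (2 * l) := by
    have : 1 / (2 * (l : ℝ)) ≤ 1 / 10 := by
      rw [div_le_div_iff₀ (by positivity) (by norm_num)]; linarith
    have : (6 : ℝ) / 24 ≤ ((l : ℝ) + 1) / 24 := by
      rw [div_le_div_iff₀ (by norm_num) (by norm_num)]; linarith
    linarith
  have hQ' : (((l : ℝ) + 1) / 24 - 1 / (2 * l)) * 24 ≤ (((l : ℝ) + 1) / 24 - 1 / (2 * l)) * Q :=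
    mul_le_mul_of_nonneg_left hQ hκ.le
  have h24 : (((l : ℝ) + 1) / 24 - 1 / (2 * l)) * 24 = ((l : ℝ) + 1) - 12 / l := by
    field_simp
    ring
  have h12 : 12 / (l : ℝ) ≤ 12 / 5 := div_le_div_of_nonneg_left (by norm_num) (by norm_num) hl5
  have hpi : Real.log Real.pi ≤ 2 * Real.log 2 := by
    have h4 : Real.log Real.pi ≤ Real.log 4 := Real.log_le_log Real.pi_pos Real.pi_le_four
    have h22 : Real.log 4 = 2 * Real.log 2 := by
      rw [show (4 : ℝ) = 2 ^ 2 by norm_num, Real.log_pow]; norm_num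
    linarith
  have hlog2 := Real.log_two_lt_d9
  have hmul : ((l : ℝ) + 5) / 4 * Real.log Real.pi ≤ ((l : ℝ) + 5) / 4 * (2 * Real.log 2) :=
    mul_le_mul_of_nonneg_left hpi (by positivity)
  have hmul' : ((l : ℝ) + 5) / 4 * (2 * Real.log 2) < ((l : ℝ) + 5) / 4 * (2 * 0.6931471808) := by
    apply mul_lt_mul_of_pos_left _ (by positivity)
    linarith
  rw [h24] at hQ'
  nlinarith

/-- **THE PER-IMAGE INEQUALITY OVER PRINT's (Ind2) IS FALSE AT EVERY GENUINE DATUM WITH `l ≥ 5` AND `log q^{∤2l}(λ) ≥ 24`.**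
For a genuine Θ-volume datum `T` at a `λ`-line point `P ∈ U` and a prime `l ≥ 5` with `log q^{∤{2,l}}(λ) ≥ 24` (every tabulated
Szpiro-bad datum of the cell has `log q^{∤2l} > 40`), and ANY family `H` of subgroups of the packet automorphisms of `T`'s genuine packets
DOMINATED BY PRINT's (Ind2) (factorwise c312-1 `Real.ismIsm (analyticLogv K) v̲_b`, [IUTchIII] Thm. 3.11 (i) (Ind2); [IUTchII] Ex. 1.8 (iv)):
`¬ ( −|log(q)| ≤ Σ_{p} ln ν̄_{𝕃_p}(hull of the H-orbit of O_𝕃(−P_Θ)) + ((l+5)/4)·log π )` — the (P)-form of [IUTchIII] Cor. 3.12 at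
the datum with the Θ-side computed over print's factorwise `Ism` INSTEAD OF the Dupuy–Hilado container FAILS: zero (Ind2)-gain
(`sum_lnνLp_hull_printInd2_eq_neg_ndegLgp`), and at zero gain the squeeze reads `κ_l·log q^{∤2l}(λ) ≤ ((l+5)/4)·log π` (this lineage's
p500550). READING (about OUR typings): the (Ind2)-gain that makes the cell's TYPED `Cor312PerImageOf` hold at the tabulated data comes
from container elements OUTSIDE print's `Ism` as typed by c312-1 (lattice shears / non-isometries, `GL_{ℤ_p}(I_v) ∖ ℤ_p^×`); whether
print's EFFECTIVE indeterminacy at `v ∈ 𝕍^bad` is this factorwise `Ism` (ref-b F-B28-1: reading matter), and (Ind1), (Ind3), the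
log-link, Cor. 3.12 itself, are untouched; nothing here asserts that abc is proved or refuted; no side taken.
[cite: Mochizuki2012, IUTchIII Cor. 3.12 p. 173–174; Thm. 3.11 (i) p. 154] [cite: Mochizuki2012, IUTchIV Thm. 1.10 Steps (v)–(viii) p. 27–31]
[cite: DupuyHilado2025, §4.9, §4.12] [claim: Mochizuki2012, status: disputed] -/
theorem not_perImage_printInd2_of_le (hU : P.InU) (h5 : 5 ≤ l) (hQ : 24 ≤ logQAvoid P {2, l}) :
    letI := T.instFieldF; letI := T.instNumberFieldF; letI := T.instFieldK; letI := T.instNumberFieldK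
    letI := T.instAlgebraK; letI := T.instIsElliptic
    ∀ (H : (p : ℕ) → (hp : p.Prime) → (j : ℕ) →
        (e : Fin (j + 1) → placesOver (Literature.IUT.HodgeTheaters.fieldOfModuli T.E) p) →
        haveI : Fact p.Prime := ⟨hp⟩
        Subgroup (PacketAlgebra p (fun b => (T.I.σ.localFields p).k (e b)) ≃ₗ[ℚ_[p]]
          PacketAlgebra p (fun b => (T.I.σ.localFields p).k (e b)))),
      (∀ (p : ℕ) (hp : p.Prime), haveI : Fact p.Prime := ⟨hp⟩
        ∀ j e, ∀ g ∈ H p hp j e,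
          ∃ ψ : ∀ b : Fin (j + 1), Carrier (.inr (T.I.σ.lift (e b).1) : Thm311.Real.Place T.K) ≃ₗ[ℚ]
              Carrier (.inr (T.I.σ.lift (e b).1) : Thm311.Real.Place T.K),
            (∀ b, ψ b ∈ ismIsm (analyticLogv T.K) (T.I.σ.lift (e b).1)) ∧
            ∀ x : ∀ b, (T.I.σ.localFields p).k (e b),
              (g : PacketAlgebra p (fun b => (T.I.σ.localFields p).k (e b)) ≃ₗ[ℚ_[p]]
                  PacketAlgebra p (fun b => (T.I.σ.localFields p).k (e b))) (PiTensorProduct.tprod ℚ_[p] x) =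
                PiTensorProduct.tprod ℚ_[p] (fun b =>
                  RescaledCompletion.of T.K p (T.I.σ.lift (e b).1) (T.I.σ.natCast_mem_lift (e b))
                    (ψ b ((RescaledCompletion.of T.K p (T.I.σ.lift (e b).1) (T.I.σ.natCast_mem_lift (e b))).symm (x b))))) →
      ¬ (T.negAbsLogQ ≤
          (∑ p ∈ T.I.supportPrimes,
            if hp : p.Prime then
              (haveI : Fact p.Prime := ⟨hp⟩
               (T.I.packetAt p hp).lnνLp T.I.lstar (fun j e =>
                 packetHull p (fun b => (T.I.σ.localFields p).k (e b))
                   (⋃ g : H p hp j e, (g : PacketAlgebra p (fun b => (T.I.σ.localFields p).k (e b)) ≃ₗ[ℚ_[p]]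
                       PacketAlgebra p (fun b => (T.I.σ.localFields p).k (e b))) ''
                     (T.I.packetAt p hp).pilotRegion (T.I.tΘ p hp) j e)))
            else 0) + ThetaVolumeInput.archLogTheta l) := by
  letI := T.instFieldF; letI := T.instNumberFieldF; letI := T.instFieldK; letI := T.instNumberFieldK
  letI := T.instAlgebraK; letI := T.instIsElliptic
  intro H hH h
  have hl' : ThetaVolumeInput.archLogTheta T.I.l = ThetaVolumeInput.archLogTheta l := by rw [T.l_eq]
  rw [← hl'] at h
  have hgap := T.I.gap_le_arch_of_perImage_printInd2 H hH h
  have hg : T.gap = LgpDivisor.ndegLgp T.I.X.thetaPilot - FinDivisor.ndeg _ T.I.X.qPilot := rfl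
  rw [← hg, PointDict.gap_eq T hU, hl'] at hgap
  exact absurd hgap (not_le.mpr (arch_lt_gap_of_le h5 hQ))

end ThetaVolumeDatumAt

end Cor22

end Literature.IUT.LogVolume

end
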